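import Summits.BirchSwinnertonDyer.BirchSwinnertonDyer.Theses.GenusKolyvaginAtTwo
import Summits.BirchSwinnertonDyer.BirchSwinnertonDyer.Theorems.GenusKolyvaginAtTwoMinimalTwinBSDTwoSwappedPairStarCertificate
import Summits.BirchSwinnertonDyer.BirchSwinnertonDyer.Theorems.GenusKolyvaginAtTwoMinimalTwinBSDTwoAllDepthLedger
import Literature.NumberTheory.EllipticCurves.KrizLi2019.TwoPartBSDTwists
import HarnessLib

/-!
# Route `GenusKolyvaginAtTwo`, crux U₂ `MinimalTwinBSDTwo` (stmt-BirchSwinnertonDyer-22985), LINE 23 «twin_swap»: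
# THE KRIZ–LI PACKET DOOR — `BSD₂` on the whole Kriz–Li twist packet of a (★)-anchored rank-one `2`-Selmer-minimal curve,
# from the rank-zero wall, PRINT, and Kriz–Li 2019 Thm. 5.1 (2)

Seat `bsd-line-gk2-p2` g29 (PROVER 2/3, cell `bsd-f1-sign2`; LINE 23 holder), `--supports stmt-BirchSwinnertonDyer-22985` (helper; closes nothing).
THEOREMS ONLY (no definition, no named fact, no `sorry`); standard axioms.  **BSD is NOT proved by this file; U₂ is NOT proved; no item is
closed.**  Everything is CONDITIONAL (D-0014) on displayed named facts: the four PRINT items of the route (Gross–Zagier `gross_zagier`, GZK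
`rank_eq_analyticRank_of_analyticRank_le_one`, modularity `hasEntireLFunction_rat`, Milne `Milne1972.bsdQuotient_baseChange_quadratic_anyModel`),
Kriz–Li 2019 Thm. 5.1 (2) (`KrizLi2019.thm112_bsdTwo_twist`, PUBLISHED, statement-only), and LINE 23's anchor S1 = the rank-`0` wall on
`2`-Selmer-trivial non-CM curves (items 19095–19098 of route ByReductionTypeAtTwo, by name in §2).

WHAT IS NEW.  Kriz–Li 2019 Thm. 5.1 (2) [FMS p. 30] transports `BSD(2)` from an ANCHOR PAIR `(E, E^{(d_K)})` — there verified NUMERICALLY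
(Rem. 5.2: Miller 2011, `N ≤ 5000`) — to every twist pair `(E^{(d)}, E^{(d·d_K)})`, `d ∈ 𝒩` (square-free products `≡ 1 (mod 4)` of primes
`ℓ ∤ 2N` split in `K` with `a_ℓ(E)` odd), `χ_d(−N) = 1`, for `E` with `E(ℚ)[2] = 0`, a Heegner field `K` with `2` split and Assumption (★),
`c₂(E)` odd (and odd Manin constant if additive at `2`).  g24's (★)-door (`Star.bsdp_of_wall_of_assumptionStar_twinTrivial_of_facts`, p-file
`…StarCertificate`) DISCHARGES the first numerical hypothesis `BSD(2)(E)` for a rank-ONE, `#Sel₂ = 2`, odd-`C(E)` anchor from the wall + PRINT +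
the (★) certificate + a `2`-Selmer-trivial twin `E^{(d_K)}` inside the genus budget; the wall discharges the second, `BSD(2)(E^{(d_K)})`
(`r_an = 0` by Gross–Zagier through the (★)-certified Heegner point, `#Sel₂ = 1`).  Hence:

* §1 `bsdp_packet_of_wall_of_assumptionStar_twinTrivial_of_facts` — **for every `d ∈ 𝒩(W, K)` with `χ_d(−N_W) = 1` and all globally minimal
  models `W₁ ≅ W^{(d)}`, `W₂ ≅ W^{(d·d_K)}`: `BSDp W₁ 2 ∧ BSDp W₂ 2`** ⟸ S1 + PRINT + KL Thm. 5.1 (2) + ONE (★)-certified anchor frame.  One of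
  `W₁, W₂` is again a rank-one curve (Kriz–Li Thm. 4.3), so this is U₂ ON THE WHOLE PACKET of the anchor — infinitely many rank-one non-CM
  curves of unbounded conductor per anchor — with NO per-member certificate and NO numerical `BSD(2)` input: the only beyond-print input left is
  the rank-zero wall (the route's anchor), exactly as for the anchor itself.
* §2 `bsdp_packet_of_wallItems_of_assumptionStar_twinTrivial` — the same BY NAME from the route's items: WALL row 1 (`GoodOrdinaryRankZeroAtTwo`,
  `MultiplicativeRankZeroAtTwo`, `SupersingularRankZeroAtTwo`, `AdditiveRankZeroAtTwo`), PRINT (`GrossZagierAllLevels` 24148,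
  `MultPublishedInputsAtTwo` 19921, `EntireLFunctionRat` 19273, `MilneAnyModel` 24149) and `KrizLi2019.thm112_bsdTwo_twist`.

NOT claimed: that every U₂-curve lies in such a packet (Kriz–Li Rem. 1.14: «not known in general how to show this directly»); (★) fails off the
odd-`C(W)` cell and is a per-pair `2`-adic computation (Ex. 6.1–6.4).  This is a DOOR (a certificate format), not a weakening of U₂.
PRESEARCH: the transport is [corpus: doi-10-1017-fms-2019-9, Thm. 5.1 (2), p. 30 L43–50; §5.1 strategy p. 31]; the discharge of its two `BSD(2)`
hypotheses by a class-wide rank-zero statement is not in print (KL Rem. 5.2 points to numerical verification only); composition tree-internal.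

References: [KrizLi2019] FMS Thm. 5.1 (2) (= arXiv:1606.03172 Thm. 1.12), Thm. 4.3, §4 (★), Lemma 5.4, Rem. 1.14, Rem. 5.2; [GrossZagier1986]
V.§2 (2.2); [GrossLMS1991] §5 Prop. 5.3; [Milne1972ArithmeticAV] §1 Thm. 1; [Miller2011LMS] Def. 1.1.
-/

set_option autoImplicit false
set_option linter.dupNamespace false -- `Summit.<P>.<Sub>` repeats `BirchSwinnertonDyer` (D-0017)

noncomputable section

open scoped Classical

open WeierstrassCurve NumberField Literature.NumberTheory.EllipticCurves
  Literature.NumberTheory.EllipticCurves.ModularForms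
  Literature.NumberTheory.EllipticCurves.KrizLi2019
  Summit.BirchSwinnertonDyer.BirchSwinnertonDyer.Theses.GenusKolyvaginAtTwo
  Summit.BirchSwinnertonDyer.BirchSwinnertonDyer.Theorems.CMExactDescent
  Summit.BirchSwinnertonDyer.BirchSwinnertonDyer.Theorems.GenusExact.TwinSwap

open Summit.BirchSwinnertonDyer.BirchSwinnertonDyer.Theses.ByReductionTypeAtTwo
  (GoodOrdinaryRankZeroAtTwo MultiplicativeRankZeroAtTwo SupersingularRankZeroAtTwo AdditiveRankZeroAtTwo)

namespace Summit.BirchSwinnertonDyer.BirchSwinnertonDyer.Theorems.GenusExact.TwinSwap.KrizLiPacket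

/-! ## §1 The packet door from the facts -/

/-- **`BSD₂` ON THE KRIZ–LI PACKET OF A (★)-ANCHORED RANK-ONE MINIMAL CURVE, from the wall, PRINT and Kriz–Li Thm. 5.1 (2).**
Facts: `hGZ hGZK hmod hMilneC` (PRINT), `hKL : KrizLi2019.thm112_bsdTwo_twist` (PRINT, statement-only), `hS1` = the rank-`0` wall on non-CM
`2`-Selmer-trivial curves.  Anchor: `W/ℚ` globally minimal, non-CM, `r_an = 1`, `#Sel₂(W) = 2`, `C(W)` odd; `K` imaginary quadratic with odd
`d_K ≠ −3`, Heegner for `N_W`; an odd-`c` datum `Dt`, `β`, `ι`, a level-`1` Kolyvagin–Heegner datum `d₁`, `P₀ ∈ E(K)` under `P(1)`, and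
`j : K → ℚ₂` with Kriz–Li's `AssumptionStar W Dt K P₀ j` (which includes «`2` splits in `K`»); `Wd` a globally minimal model of `W^{(d_K)}` with
`#Sel₂(Wd) = 1` inside the genus budget.  THEN for every `d ∈ 𝒩(W, K)` (`KrizLi2019.InN W K d`) with `χ_d(−N_W) = 1`
(`Int.sign d * jacobiSym N_W |d| = 1`) and all globally minimal `W₁ ≅ W^{(d)}`, `W₂ ≅ W^{(d·d_K)}`: `BSDp W₁ 2 ∧ BSDp W₂ 2`.
Proof: g24's (★)-door gives `BSDp W 2`; Gross–Zagier through the Heegner point under `P(1)` (of infinite order by (★)) gives `r_an(Wd) = 0`,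
so `hS1` gives `BSDp Wd 2`; `E(ℚ)[2] = 0` from `#Sel₂ = 2` and `rank = r_an = 1` (GZK); `c₂(W)` odd from `C(W)` odd; then Kriz–Li Thm. 5.1 (2).
CONDITIONAL on the displayed facts; BSD is NOT proved.
[cite: KrizLi2019, Thm. 5.1 (2) (FMS p. 30 L43–50) = arXiv:1606.03172 Thm. 1.12; Lemma 5.4] [cite: GrossZagier1986, V.§2 (2.2)]
[cite: Milne1972ArithmeticAV, §1 Thm. 1] -/
theorem bsdp_packet_of_wall_of_assumptionStar_twinTrivial_of_facts
    (hGZ : ∀ (N : ℕ) [NeZero N] (W : WeierstrassCurve ℚ) (K : Type) [Field K] [NumberField K], gross_zagier N W K)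
    (hGZK : rank_eq_analyticRank_of_analyticRank_le_one) (hmod : hasEntireLFunction_rat)
    (hMilneC : Milne1972.bsdQuotient_baseChange_quadratic_anyModel)
    (hKL : thm112_bsdTwo_twist)
    (hS1 : ∀ (W : WeierstrassCurve ℚ) [W.IsElliptic] [W.IsGloballyMinimal],
      ¬ W.HasCM → W.analyticRank = 0 → Nat.card (W.selmerGroup 2) = 1 → BSDp W 2)
    (W : WeierstrassCurve ℚ) [W.IsElliptic] [W.IsGloballyMinimal] [NeZero (W.conductorNorm ℤ)]
    (hcm : ¬ W.HasCM) (hr : W.analyticRank = 1) (hSel : Nat.card (W.selmerGroup 2) = 2) (hT : Odd W.tamagawaProduct)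
    (K : Type) [Field K] [NumberField K] (hIQ : IsImaginaryQuadratic K) (hodd : Odd (NumberField.discr K))
    (h3 : NumberField.discr K ≠ -3) (hHe : SatisfiesHeegnerHypothesis (W.conductorNorm ℤ) K)
    (Dt : ModularParametrizationData W (W.conductorNorm ℤ)) (hc : Odd Dt.c) (β : ℤ) (ι : K →+* ℂ)
    (d₁ : KolyvaginHeegnerData Dt β ι 1) (P₀ : (W.baseChange K).toAffine.Point)
    (hP₀K : WeierstrassCurve.Affine.Point.map (W' := W) (algebraMap K (ringClassField K ι 1)).toRatAlgHom P₀ = d₁.derivedPoint)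
    (j : K →ₐ[ℚ] ℚ_[2]) (hstar : AssumptionStar W Dt K P₀ j)
    (Wd : WeierstrassCurve ℚ) [Wd.IsElliptic] [Wd.IsGloballyMinimal]
    (hWd : ∃ C : VariableChange ℚ, C • W.quadraticTwist (NumberField.discr K : ℚ) = Wd) (hSel1 : Nat.card (Wd.selmerGroup 2) = 1)
    (hbud : (W.Δ < 0 ∧ padicValNat 2 Wd.tamagawaProduct ≤ 1) ∨ padicValNat 2 Wd.tamagawaProduct = 0)
    (d : ℤ) (hd : InN W K d) (hsign : Int.sign d * jacobiSym (W.conductorNorm ℤ) d.natAbs = 1)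
    (W₁ W₂ : WeierstrassCurve ℚ) [W₁.IsElliptic] [W₁.IsGloballyMinimal] [W₂.IsElliptic] [W₂.IsGloballyMinimal]
    (hW₁ : ∃ C : VariableChange ℚ, C • W₁ = W.quadraticTwist (d : ℚ))
    (hW₂ : ∃ C : VariableChange ℚ, C • W₂ = W.quadraticTwist ((d * NumberField.discr K : ℤ) : ℚ)) :
    BSDp W₁ 2 ∧ BSDp W₂ 2 := by
  haveI : Fact (Nat.Prime 2) := ⟨Nat.prime_two⟩
  -- (1) the anchor: `BSDp W 2` by g24's (★)-door
  have hBSDW : BSDp W 2 :=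
    Star.bsdp_of_wall_of_assumptionStar_twinTrivial_of_facts hGZ hGZK hmod hMilneC hS1 W hcm hr hSel hT K hIQ hodd h3 hHe
      Dt hc β ι d₁ P₀ hP₀K j hstar Wd hWd hSel1 hbud
  -- (2) the twin: `BSDp Wd 2` by the wall (non-CM, `r_an = 0` through the Heegner point, `#Sel₂ = 1`)
  obtain ⟨Cd, hCd⟩ := hWd
  have hdK : (NumberField.discr K : ℚ) ≠ 0 := by exact_mod_cast NumberField.discr_ne_zero K
  haveI := W.isElliptic_quadraticTwist hdK
  have hcmd : ¬ Wd.HasCM := GenusKoly.twin_not_hasCM W hcm hdK Wd ⟨Cd, hCd⟩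
  have hc2 : Odd ((W.baseChange ℚ_[2]).localTamagawaNumber ℤ_[2]) :=
    hT.of_dvd_nat (BoxerDiao2010.localTamagawaNumber_padic_dvd_tamagawaProduct W 2)
  obtain ⟨P₁, Hd, hP₁, hP₁K⟩ := exists_heegnerPoint_map_eq_derivedPoint_one hIQ hHe d₁
  have hP₁₀ : P₁ = P₀ :=
    WeierstrassCurve.Affine.Point.map_injective (W' := W) _ (hP₁K.trans hP₀K.symm)
  have hy : ¬ IsOfFinAddOrder d₁.derivedPoint := by
    intro hfin
    apply not_isOfFinAddOrder_of_assumptionStar W Dt K P₀ j hstar hc2 hc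
    rw [← hP₀K] at hfin
    exact (WeierstrassCurve.Affine.Point.map_injective (W' := W) _).isOfFinAddOrder_iff.mp hfin
  have hPinf : ¬ IsOfFinAddOrder P₁ := by
    intro hfin
    apply hy
    rw [← hP₁K]
    exact (WeierstrassCurve.Affine.Point.map (W' := W) (algebraMap K (ringClassField K ι 1)).toRatAlgHom).isOfFinAddOrder hfin
  have hrt := analyticRank_twist_eq_zero_of_rankOne W K (hGZ _ W K) hmod hIQ hHe hr ⟨Dt, Hd, ι, hP₁⟩ hPinf
  have hrd : Wd.analyticRank = 0 := by rw [← hCd, analyticRank_smul, hrt]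
  have hBSDWd : BSDp Wd 2 := hS1 Wd hcmd hrd hSel1
  -- (3) `E(ℚ)[2] = 0` from `#Sel₂ = 2` and `rank W(ℚ) = r_an = 1`
  have hrk : 1 ≤ W.mordellWeilRank := by
    have h := (hGZK W (le_of_eq hr)).1
    omega
  obtain ⟨-, hT2, -⟩ := rank_eq_one_and_sha_primary_eq_zero_of_natCard_selmerGroup_eq_two W hSel hrk
  have hT2' : ∀ Q : W.toAffine.Point, 2 • Q = 0 → Q = 0 := fun Q hQ ↦ by convert hT2 Q (by convert hQ)
  -- (4) the models: `Cd⁻¹ • Wd = W^{(d_K)}`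
  have hWd' : ∃ C : VariableChange ℚ, C • Wd = W.quadraticTwist (NumberField.discr K : ℚ) :=
    ⟨Cd⁻¹, by rw [← hCd, inv_smul_smul]⟩
  -- (5) Kriz–Li Thm. 5.1 (2)
  have hstar₁ : AssumptionStar W Dt K P₁ j := by rw [hP₁₀]; exact hstar
  exact hKL W hT2' K hIQ hHe Dt Hd ι P₁ hP₁ j hstar₁ ⟨hc2, fun _ _ ↦ hc⟩ Wd hWd' hBSDW hBSDWd d hd hsign W₁ W₂ hW₁ hW₂

/-! ## §2 By name from the route's items -/

/-- **THE PACKET DOOR BY NAME.**  WALL row 1 items of route ByReductionTypeAtTwo (`GoodOrdinaryRankZeroAtTwo` 19095, `MultiplicativeRankZeroAtTwo`,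
`SupersingularRankZeroAtTwo`, `AdditiveRankZeroAtTwo`), this route's PRINT items (`GrossZagierAllLevels` 24148, `MultPublishedInputsAtTwo` 19921,
`EntireLFunctionRat` 19273, `MilneAnyModel` 24149) and Kriz–Li Thm. 5.1 (2) (`KrizLi2019.thm112_bsdTwo_twist`) give `BSDp` on both members of every
twist pair `(W^{(d)}, W^{(d·d_K)})`, `d ∈ 𝒩(W,K)`, `χ_d(−N_W) = 1`, of a (★)-anchored rank-one `2`-Selmer-minimal odd-`C(W)` curve `W` with a
`2`-Selmer-trivial twin by `d_K` inside the budget (binders as in §1).  CONDITIONAL on the items; closes nothing; BSD is NOT proved.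
[cite: KrizLi2019, Thm. 5.1 (2) (FMS p. 30)] [cite: GrossZagier1986, V.§2 (2.2)] [cite: Milne1972ArithmeticAV, §1 Thm. 1] -/
theorem bsdp_packet_of_wallItems_of_assumptionStar_twinTrivial
    (hOrd : GoodOrdinaryRankZeroAtTwo) (hMult : MultiplicativeRankZeroAtTwo) (hSS : SupersingularRankZeroAtTwo) (hAdd : AdditiveRankZeroAtTwo)
    (hGZ : GrossZagierAllLevels) (hGZK : MultPublishedInputsAtTwo) (hL : EntireLFunctionRat) (hMi : MilneAnyModel)
    (hKL : thm112_bsdTwo_twist)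
    (W : WeierstrassCurve ℚ) [W.IsElliptic] [W.IsGloballyMinimal] [NeZero (W.conductorNorm ℤ)]
    (hcm : ¬ W.HasCM) (hr : W.analyticRank = 1) (hSel : Nat.card (W.selmerGroup 2) = 2) (hT : Odd W.tamagawaProduct)
    (K : Type) [Field K] [NumberField K] (hIQ : IsImaginaryQuadratic K) (hodd : Odd (NumberField.discr K))
    (h3 : NumberField.discr K ≠ -3) (hHe : SatisfiesHeegnerHypothesis (W.conductorNorm ℤ) K)
    (Dt : ModularParametrizationData W (W.conductorNorm ℤ)) (hc : Odd Dt.c) (β : ℤ) (ι : K →+* ℂ)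
    (d₁ : KolyvaginHeegnerData Dt β ι 1) (P₀ : (W.baseChange K).toAffine.Point)
    (hP₀K : WeierstrassCurve.Affine.Point.map (W' := W) (algebraMap K (ringClassField K ι 1)).toRatAlgHom P₀ = d₁.derivedPoint)
    (j : K →ₐ[ℚ] ℚ_[2]) (hstar : AssumptionStar W Dt K P₀ j)
    (Wd : WeierstrassCurve ℚ) [Wd.IsElliptic] [Wd.IsGloballyMinimal]
    (hWd : ∃ C : VariableChange ℚ, C • W.quadraticTwist (NumberField.discr K : ℚ) = Wd) (hSel1 : Nat.card (Wd.selmerGroup 2) = 1)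
    (hbud : (W.Δ < 0 ∧ padicValNat 2 Wd.tamagawaProduct ≤ 1) ∨ padicValNat 2 Wd.tamagawaProduct = 0)
    (d : ℤ) (hd : InN W K d) (hsign : Int.sign d * jacobiSym (W.conductorNorm ℤ) d.natAbs = 1)
    (W₁ W₂ : WeierstrassCurve ℚ) [W₁.IsElliptic] [W₁.IsGloballyMinimal] [W₂.IsElliptic] [W₂.IsGloballyMinimal]
    (hW₁ : ∃ C : VariableChange ℚ, C • W₁ = W.quadraticTwist (d : ℚ))
    (hW₂ : ∃ C : VariableChange ℚ, C • W₂ = W.quadraticTwist ((d * NumberField.discr K : ℤ) : ℚ)) :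
    BSDp W₁ 2 ∧ BSDp W₂ 2 :=
  bsdp_packet_of_wall_of_assumptionStar_twinTrivial_of_facts hGZ hGZK hL hMi hKL
    (AllDepth.minimalRankZeroBSDTwo_of_wallItems hOrd hMult hSS hAdd) W hcm hr hSel hT K hIQ hodd h3 hHe Dt hc β ι d₁ P₀ hP₀K j hstar
    Wd hWd hSel1 hbud d hd hsign W₁ W₂ hW₁ hW₂

end Summit.BirchSwinnertonDyer.BirchSwinnertonDyer.Theorems.GenusExact.TwinSwap.KrizLiPacket

end
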